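import Mathlib.Analysis.InnerProductSpace.Projection.Submodule
import HarnessLib

/-!
# Orthogonal projections onto a decreasing sequence of closed subspaces

For an antitone family `U` of closed subspaces (each with an orthogonal projection) of a Hilbert
space `E`, the orthogonal projections `P_{U i} x` converge, along `atTop`, to the projection of `x`
onto the intersection `⨅ i, U i` (von Neumann's theorem on monotone sequences of projections;
e.g. Kadison–Ringrose, *Fundamentals of the theory of operator algebras I*, Prop. 2.5.6, or Halmos,
*Introduction to Hilbert space*, §29).  Mathlib has the increasing version
`Submodule.starProjection_tendsto_closure_iSup`; the decreasing one follows by passing to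
orthogonal complements: `(U i)ᗮ` is monotone and `closure (⨆ i, (U i)ᗮ) = (⨅ i, U i)ᗮ`.

* `topologicalClosure_iSup_orthogonal` — `closure (⨆ i, (U i)ᗮ) = (⨅ i, U i)ᗮ`;
* `hasOrthogonalProjection_iInf` — `⨅ i, U i` has an orthogonal projection;
* `starProjection_tendsto_iInf` — `P_{U i} x → P_{⨅ U} x` for antitone `U`.

Used by the germ σ-algebra theory of Gaussian linear processes. Mathlib: verified absent at the
pin (`lean search 'tendsto_iInf|antitone' ` in `InnerProductSpace/Projection`).
-/

open Filter
open scoped Topology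

namespace Literature.Analysis.InnerProduct

variable {𝕜 E : Type*} [RCLike 𝕜] [NormedAddCommGroup E] [InnerProductSpace 𝕜 E] [CompleteSpace E]

/-- For subspaces `U i` with orthogonal projections of a Hilbert space, the closure of the span of
the orthogonal complements is the orthogonal complement of the intersection:
`closure (⨆ i, (U i)ᗮ) = (⨅ i, U i)ᗮ`. [folklore] -/
theorem topologicalClosure_iSup_orthogonal {ι : Type*} (U : ι → Submodule 𝕜 E)
    [∀ i, (U i).HasOrthogonalProjection] :
    (⨆ i, (U i)ᗮ).topologicalClosure = (⨅ i, U i)ᗮ := by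
  rw [← Submodule.orthogonal_orthogonal_eq_closure, ← Submodule.iInf_orthogonal]
  congr 1
  exact iInf_congr fun i => Submodule.orthogonal_orthogonal (U i)

/-- The intersection of subspaces with orthogonal projections is an orthogonal complement
(`⨅ i, U i = (⨆ i, (U i)ᗮ)ᗮ`), hence has an orthogonal projection. [folklore] -/
theorem hasOrthogonalProjection_iInf {ι : Type*} (U : ι → Submodule 𝕜 E)
    [∀ i, (U i).HasOrthogonalProjection] : (⨅ i, U i).HasOrthogonalProjection := by
  have h : (⨅ i, U i) = (⨆ i, (U i)ᗮ)ᗮ := by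
    rw [← Submodule.iInf_orthogonal]
    exact iInf_congr fun i => (Submodule.orthogonal_orthogonal (U i)).symm
  rw [h]
  infer_instance

/-- **Projections onto a decreasing family converge to the projection onto the intersection**:
for an antitone family `U` of subspaces with orthogonal projections of a Hilbert space and every
`x`, `P_{U i} x → P_{⨅ i, U i} x` along `atTop` (von Neumann; Kadison–Ringrose Prop. 2.5.6).
Proof: `P_{U i} = 1 - P_{(U i)ᗮ}`, the complements increase, and Mathlib's
`starProjection_tendsto_closure_iSup` with `closure (⨆ (U i)ᗮ) = (⨅ U i)ᗮ`. [folklore] -/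
theorem starProjection_tendsto_iInf {ι : Type*} [Preorder ι] (U : ι → Submodule 𝕜 E)
    [∀ i, (U i).HasOrthogonalProjection] [(⨅ i, U i).HasOrthogonalProjection]
    (hU : Antitone U) (x : E) :
    Tendsto (fun i => (U i).starProjection x) atTop (𝓝 ((⨅ i, U i).starProjection x)) := by
  have hmono : Monotone fun i => (U i)ᗮ := fun i j hij => Submodule.orthogonal_le (hU hij)
  haveI : (⨆ i, (U i)ᗮ).topologicalClosure.HasOrthogonalProjection := by
    rw [topologicalClosure_iSup_orthogonal U]
    infer_instance
  have h := Submodule.starProjection_tendsto_closure_iSup (fun i => (U i)ᗮ) hmono x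
  have hlim : (⨆ i, (U i)ᗮ).topologicalClosure.starProjection x = x - (⨅ i, U i).starProjection x := by
    have h1 : (⨆ i, (U i)ᗮ).topologicalClosure.starProjection x = (⨅ i, U i)ᗮ.starProjection x := by
      congr 2
      exact topologicalClosure_iSup_orthogonal U
    rw [h1, Submodule.starProjection_orthogonal' (⨅ i, U i)]
    simp
  rw [hlim] at h
  have h2 : Tendsto (fun i => x - (U i)ᗮ.starProjection x) atTop
      (𝓝 (x - (x - (⨅ i, U i).starProjection x))) := tendsto_const_nhds.sub h
  simp only [sub_sub_cancel] at h2
  refine h2.congr fun i => ?_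
  rw [Submodule.starProjection_orthogonal' (U i)]
  simp

end Literature.Analysis.InnerProduct
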